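import Summits.QuantumFields.GaugeBoot.ClassBRowSU2
import Summits.QuantumFields.GaugeBoot.ZdPairLoopClasses
import HarnessLib

/-!
# Rows as data for Class-B states, `SU(2)` trace rows: two decompositions with the same double trace (gauge-boot, Class-B rows, supplement 2)

HONEST FRAMING (cell `pub-gaugeboot`, page 1 of every file): the venture produces certified bounds
on lattice expectations at stated coupling, gauge group, dimension and torus size; NOT a mass gap,
NOT a continuum limit, NOT a string tension; NOT Yang–Mills-summit-bearing (barriers
`FixedCouplingUltralocality`, `PerturbativeInvisibility`).

`MMRowSU2.lean` has two soundness theorems: `rowSum_mmRowSU2` (single-link Schwinger–Dyson rows; its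
`ℤ³` / Class-B twin is `ClassBRowSU2.rowSumZd_mmRowSU2`) and `rowSum_traceRowSU2` — the `SU(2)` TRACE
rows `w(C₁C₂) + w(C₁C₂⁻¹) − w(D₁D₂) − w(D₁D₂⁻¹) = 0` of two decompositions whose positioned pairs
`(C₁, C₂)`, `(D₁, D₂)` are joined by checked pair scripts (`trOK`, one `decide` per row; G1
`su2_trace_rows` + `eliminate_su2_double_traces`). This file is the `ℤ³` twin of the second theorem:

* **`rowSumZd_traceRowSU2`** — `rowSumZd μ β (traceRowSU2 C₁ C₂ D₁ D₂ cs) = 0` whenever `trOK … = true`,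
  for every finite measure `μ` on `LGConfig 3 SU(2)` invariant under translations, axis permutations and
  axis reflections (NO Haar-shift identity needed: trace rows are kinematic), via `su2_rawTrace_zd` and
  `pairExpZd_run` (`ZdPairLoopClasses.lean`) and the relabelling of `ClassBRowSU2.lean`;
* `rowSumZd_of_TRCheck`; **`ClassBState.rowSumZd_traceRowSU2`**, **`ClassBState.rowSumZd_of_TRCheck`**.

With `ClassBRowSU2.lean`: BOTH row families of the existing `SU(2)`, `D = 3` data modules hold verbatim on
every Class-B state. Everything is `[folklore]`.
-/

noncomputable section

open MeasureTheory
open scoped Matrix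
open Literature.Probability.LatticeModels (Site)
open Literature.MathematicalPhysics.QuantumLattice (LGConfig ZdEdge IsZdTranslationInvariant)

namespace Summit.QuantumFields.GaugeBoot

variable {μ : Measure (LGConfig 3 (SU 2))} [IsFiniteMeasure μ] (β : ℝ)

/-- **Soundness of the trace row on a state of `ℤ³`**: it vanishes at every coupling when `trOK` holds,
for every finite measure invariant under translations, axis permutations and axis reflections. [folklore] -/
theorem rowSumZd_traceRowSU2 (hT : IsZdTranslationInvariant μ)
    (hP : ∀ σ : Equiv.Perm (Fin 3), MeasurePreserving (configPerm σ) μ μ)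
    (hR : ∀ i : Fin 3, MeasurePreserving (configSiteReflect i) μ μ) (C₁ C₂ D₁ D₂ : Word 3)
    (sa sb cs : List ℕ) (h : trOK C₁ C₂ D₁ D₂ sa sb = true) :
    rowSumZd μ β (traceRowSU2 C₁ C₂ D₁ D₂ cs) = 0 := by
  simp only [trOK, Bool.and_eq_true, Bool.or_eq_true, decide_eq_true_eq] at h
  obtain ⟨⟨⟨⟨⟨⟨h₁, h₂⟩, h₃⟩, h₄⟩, ha⟩, hb⟩, hrun⟩ := h
  have ea := su2_rawTrace_zd μ 0 C₁ C₂ h₁ h₂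
  have eb := su2_rawTrace_zd μ 0 D₁ D₂ h₃ h₄
  have hW : ∀ v : Word 3, ∫ U, wordLoopZd (suRep 2) (0 : Fin 3 → ℤ) v U ∂μ = WZd μ v := fun v => rfl
  simp only [hW] at ea eb
  have pa := pairExpZd_run (suRep 2) (continuous_suRep 2) hT hP (hR 0) (pmDecode sa) (pairAt0 C₁ C₂) ha
  have pb := pairExpZd_run (suRep 2) (continuous_suRep 2) hT hP (hR 0) (pmDecode sb) (pairAt0 D₁ D₂) hb
  have hpq : pairExpZd (suRep 2) μ (⟨0, C₁⟩ : PLoop 3) ⟨0, C₂⟩ = pairExpZd (suRep 2) μ (⟨0, D₁⟩ : PLoop 3) ⟨0, D₂⟩ := by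
    change pairExpZd (suRep 2) μ (pairAt0 C₁ C₂).1 (pairAt0 C₁ C₂).2 =
      pairExpZd (suRep 2) μ (pairAt0 D₁ D₂).1 (pairAt0 D₁ D₂).2
    rw [← pa, ← pb]
    rcases hrun with e | e
    · rw [e]
    · rw [e, Prod.fst_swap, Prod.snd_swap, pairExpZd_comm]
  rw [traceRowSU2, rowSumZd_clean, rowSumZd_merge, rowSumZd_relabel β hT hP hR]
  simp only [rowSumZd_cons, rowSumZd_nil]
  change 2 * pairExpZd (suRep 2) μ (⟨0, C₁⟩ : PLoop 3) ⟨0, C₂⟩ = _ at ea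
  change 2 * pairExpZd (suRep 2) μ (⟨0, D₁⟩ : PLoop 3) ⟨0, D₂⟩ = _ at eb
  push_cast
  linear_combination eb - ea + 2 * hpq

/-- **All rows of a checked trace family vanish** on such a state, at every coupling. [folklore] -/
theorem rowSumZd_of_TRCheck (hT : IsZdTranslationInvariant μ)
    (hP : ∀ σ : Equiv.Perm (Fin 3), MeasurePreserving (configPerm σ) μ μ)
    (hR : ∀ i : Fin 3, MeasurePreserving (configSiteReflect i) μ μ) {ts : List TrData} (h : TRCheck ts = true) :
    ∀ t ∈ ts, rowSumZd μ β t.row = 0 := by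
  intro t ht
  exact rowSumZd_traceRowSU2 β hT hP hR t.C₁ t.C₂ t.D₁ t.D₂ t.sa t.sb t.cs (List.all_eq_true.1 h t ht)

/-- **Every checked `SU(2)` trace row vanishes on every Class-B state** (any coupling `β'` of the state,
any `β` in the row — trace rows do not involve the action). [folklore] -/
theorem ClassBState.rowSumZd_traceRowSU2 {β' : ℝ} (ω : ClassBState 3 (suRep 2) β') (C₁ C₂ D₁ D₂ : Word 3)
    (sa sb cs : List ℕ) (h : trOK C₁ C₂ D₁ D₂ sa sb = true) :
    rowSumZd ω.μ β (traceRowSU2 C₁ C₂ D₁ D₂ cs) = 0 := by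
  haveI := ω.isProbabilityMeasure
  exact _root_.Summit.QuantumFields.GaugeBoot.rowSumZd_traceRowSU2 β ω.translationInvariant ω.permInvariant
    ω.reflectInvariant C₁ C₂ D₁ D₂ sa sb cs h

/-- **All rows of a checked trace family vanish on every Class-B state.** [folklore] -/
theorem ClassBState.rowSumZd_of_TRCheck {β' : ℝ} (ω : ClassBState 3 (suRep 2) β') {ts : List TrData}
    (h : TRCheck ts = true) : ∀ t ∈ ts, rowSumZd ω.μ β t.row = 0 := by
  haveI := ω.isProbabilityMeasure
  exact _root_.Summit.QuantumFields.GaugeBoot.rowSumZd_of_TRCheck β ω.translationInvariant ω.permInvariant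
    ω.reflectInvariant h

end Summit.QuantumFields.GaugeBoot

end
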